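import Summits.SmoothPoincare4.SmoothPoincare4.Theorems.SymplecticOrigamiOrigamiFoldExistenceStubCleanOnePleatIroningSide

/-!
# Stub `stub_outerCleanRecognitionChart` of line `shadow-pleats` for crux `OrigamiFoldExistence` — C₀:
# shells around the fold sphere; `On`-versions of the inverse function theorem idioms (item stmt-SmoothPoincare4-7844, route SymplecticOrigami; seat c3, S4''-chart worker)

Preliminary helper file towards `stub_outerCleanRecognitionChart : OuterCleanRecognitionChart`
(used by file C, `…ChartShell`: the angular straightening of file B is a norm-preserving
diffeomorphism of a thin shell around the outer fold sphere `S(0,2)`).  Elementary content: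

* `foldShell κ = {2 - κ < ‖u‖ < 2 + κ}`, and **`exists_foldShell_subset`** (registered helper):
  an open neighbourhood of the compact sphere `S(0,2)` contains a shell (Mathlib's
  `IsCompact.exists_cthickening_subset_open`);
* for a map `F : ℝ⁴ → ℝ⁴` that is `C^∞` ON AN OPEN SET `V` with injective differential there
  (`On`-versions of idioms the S5a files `…Side` / `…Inverse` prove for globally smooth maps):
  strict differentiability with invertible derivative (`exists_hasStrictFDerivAt_equiv_on`),
  openness of images of open subsets (`isOpen_image_of_injOn_fderiv`), local injectivity
  (`exists_nhds_injOn_of_fderiv`), and smoothness of the inverse `invFunOn F V` on the image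
  when `F` is injective on `V` (`contDiffOn_invFunOn`).

Sources: Mathlib's inverse function theorem (`HasStrictFDerivAt.toOpenPartialHomeomorph`,
`ContDiffAt.to_localInverse`); J. M. Lee, *Introduction to Smooth Manifolds* (2013), Thm. 4.5.
-/

noncomputable section

-- the prescribed namespace `Summit.<P>.<Sub>.…` duplicates `SmoothPoincare4` (P = Sub)
set_option linter.dupNamespace false

open scoped Manifold ContDiff Topology RealInnerProductSpace
open Set Function Filter Metric

namespace Summit.SmoothPoincare4.SmoothPoincare4.Theorems.OrigamiFoldExistence.ShadowPleats

/-! ### Shells around the fold sphere -/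

/-- The open SHELL `{2 - κ < ‖u‖ < 2 + κ}` around the outer fold sphere. -/
def foldShell (κ : ℝ) : Set (EuclideanSpace ℝ (Fin 4)) := {u | 2 - κ < ‖u‖ ∧ ‖u‖ < 2 + κ}

/-- Membership in a shell. -/
theorem mem_foldShell {κ : ℝ} {u : EuclideanSpace ℝ (Fin 4)} : u ∈ foldShell κ ↔ 2 - κ < ‖u‖ ∧ ‖u‖ < 2 + κ :=
  Iff.rfl

/-- Shells are open. -/
theorem isOpen_foldShell (κ : ℝ) : IsOpen (foldShell κ) :=
  (isOpen_lt continuous_const continuous_norm).inter (isOpen_lt continuous_norm continuous_const)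

/-- Shells are monotone in the radius. -/
theorem foldShell_mono {κ κ' : ℝ} (h : κ ≤ κ') : foldShell κ ⊆ foldShell κ' :=
  fun _ hu => ⟨by linarith [hu.1], by linarith [hu.2]⟩

/-- The fold sphere lies in every shell of positive radius. -/
theorem mem_foldShell_of_norm {κ : ℝ} (hκ : 0 < κ) {u : EuclideanSpace ℝ (Fin 4)} (hu : ‖u‖ = 2) :
    u ∈ foldShell κ :=
  ⟨by rw [hu]; linarith, by rw [hu]; linarith⟩

/-- Points of a shell of radius `≤ 2` are non-zero. -/
theorem ne_zero_of_mem_foldShell {κ : ℝ} (hκ : κ ≤ 2) {u : EuclideanSpace ℝ (Fin 4)} (hu : u ∈ foldShell κ) :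
    u ≠ 0 := by
  rw [← norm_pos_iff]; linarith [hu.1]

/-- A point depends only on its shell membership through its norm. -/
theorem mem_foldShell_iff_of_norm_eq {κ : ℝ} {u v : EuclideanSpace ℝ (Fin 4)} (h : ‖u‖ = ‖v‖) :
    u ∈ foldShell κ ↔ v ∈ foldShell κ := by
  rw [mem_foldShell, mem_foldShell, h]

/-- **An open neighbourhood of the fold sphere contains a shell** (compactness of `S(0,2)`). -/
theorem exists_foldShell_subset {O : Set (EuclideanSpace ℝ (Fin 4))} (hO : IsOpen O)
    (hS : Metric.sphere (0 : EuclideanSpace ℝ (Fin 4)) 2 ⊆ O) : ∃ κ : ℝ, 0 < κ ∧ κ ≤ 1 ∧ foldShell κ ⊆ O := by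
  obtain ⟨δ, hδ, hsub⟩ := (isCompact_sphere (0 : EuclideanSpace ℝ (Fin 4)) 2).exists_cthickening_subset_open hO hS
  refine ⟨min δ 1, lt_min hδ one_pos, min_le_right _ _, fun u hu => hsub ?_⟩
  have hu' : u ∈ foldShell δ := foldShell_mono (min_le_left _ _) hu
  have hu0 : u ≠ 0 := by rw [← norm_pos_iff]; linarith [hu.1, min_le_right δ 1]
  refine thickening_subset_cthickening δ _ (mem_thickening_iff.2 ⟨(2 * ‖u‖⁻¹) • u, ?_, ?_⟩)
  · rw [mem_sphere_zero_iff_norm, norm_smul, Real.norm_of_nonneg (by positivity), mul_assoc,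
      inv_mul_cancel₀ (norm_ne_zero_iff.2 hu0), mul_one]
  · have hsub' : u - (2 * ‖u‖⁻¹) • u = (1 - 2 * ‖u‖⁻¹) • u := by
      rw [sub_smul, one_smul]
    rw [dist_eq_norm, hsub', norm_smul, Real.norm_eq_abs]
    have hpos : 0 < ‖u‖ := norm_pos_iff.2 hu0
    have h1 : |1 - 2 * ‖u‖⁻¹| * ‖u‖ = |‖u‖ - 2| := by
      rw [← abs_of_pos hpos, ← abs_mul, abs_of_pos hpos]
      congr 1
      field_simp
    rw [h1, abs_lt]
    constructor <;> linarith [hu'.1, hu'.2]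

/-! ### Maps smooth on an open set with injective differential: `On`-versions -/

section OnVersions

variable {F : EuclideanSpace ℝ (Fin 4) → EuclideanSpace ℝ (Fin 4)} {V : Set (EuclideanSpace ℝ (Fin 4))}

/-- At a point of an open set where a `C^∞` map has injective differential it is strictly
differentiable with an INVERTIBLE derivative. -/
theorem exists_hasStrictFDerivAt_equiv_on (hF : ContDiffOn ℝ ∞ F V) (hV : IsOpen V)
    {x : EuclideanSpace ℝ (Fin 4)} (hx : x ∈ V) (h : Injective (fderiv ℝ F x)) :
    ∃ L : EuclideanSpace ℝ (Fin 4) ≃L[ℝ] EuclideanSpace ℝ (Fin 4),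
      (L : EuclideanSpace ℝ (Fin 4) →L[ℝ] EuclideanSpace ℝ (Fin 4)) = fderiv ℝ F x ∧
      HasStrictFDerivAt F (L : EuclideanSpace ℝ (Fin 4) →L[ℝ] EuclideanSpace ℝ (Fin 4)) x := by
  refine ⟨(fderiv ℝ F x).toContinuousLinearEquivOfDetNeZero
    (Literature.Topology.FourManifolds.det_ne_zero_of_injective h), ?_, ?_⟩
  · exact ContinuousLinearMap.coe_toContinuousLinearEquivOfDetNeZero _ _
  · rw [ContinuousLinearMap.coe_toContinuousLinearEquivOfDetNeZero]
    exact (hF.contDiffAt (hV.mem_nhds hx)).hasStrictFDerivAt (by simp)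

/-- **Openness**: a map `C^∞` on an open set with injective differential there maps open subsets
to open sets (inverse function theorem). [folklore] -/
theorem isOpen_image_of_injOn_fderiv (hF : ContDiffOn ℝ ∞ F V) (hV : IsOpen V)
    (hinj : ∀ x ∈ V, Injective (fderiv ℝ F x)) {B : Set (EuclideanSpace ℝ (Fin 4))} (hB : IsOpen B)
    (hBV : B ⊆ V) : IsOpen (F '' B) := by
  rw [isOpen_iff_mem_nhds]
  rintro y ⟨x, hx, rfl⟩
  obtain ⟨L, -, hL⟩ := exists_hasStrictFDerivAt_equiv_on hF hV (hBV hx) (hinj x (hBV hx))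
  rw [← hL.map_nhds_eq_of_equiv]
  exact image_mem_map (hB.mem_nhds hx)

/-- **Local injectivity**: such a map is injective on a neighbourhood of each point. [folklore] -/
theorem exists_nhds_injOn_of_fderiv (hF : ContDiffOn ℝ ∞ F V) (hV : IsOpen V)
    {x : EuclideanSpace ℝ (Fin 4)} (hx : x ∈ V) (h : Injective (fderiv ℝ F x)) :
    ∃ U ∈ 𝓝 x, InjOn F U := by
  obtain ⟨L, -, hL⟩ := exists_hasStrictFDerivAt_equiv_on hF hV hx h
  refine ⟨(hL.toOpenPartialHomeomorph F).source,
    (hL.toOpenPartialHomeomorph F).open_source.mem_nhds hL.mem_toOpenPartialHomeomorph_source, ?_⟩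
  have := (hL.toOpenPartialHomeomorph F).injOn
  rwa [HasStrictFDerivAt.toOpenPartialHomeomorph_coe] at this

/-- **Smooth inverse**: a map `C^∞` on an open set `V`, injective on `V` with injective
differential, has the `C^∞` left inverse `invFunOn F V` on the (open) image `F(V)`. [folklore] -/
-- adapted from `exists_contDiffOn_leftInverse` (…StubCleanOnePleatIroningInverse), `On`-version
theorem contDiffOn_invFunOn (hF : ContDiffOn ℝ ∞ F V) (hV : IsOpen V) (hinj : InjOn F V)
    (himm : ∀ x ∈ V, Injective (fderiv ℝ F x)) : ContDiffOn ℝ ∞ (invFunOn F V) (F '' V) := by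
  rintro y ⟨a, ha, rfl⟩
  obtain ⟨L, -, hFs⟩ := exists_hasStrictFDerivAt_equiv_on hF hV ha (himm a ha)
  have hfa : ContDiffAt ℝ ∞ F a := hF.contDiffAt (hV.mem_nhds ha)
  have hn : (∞ : WithTop ℕ∞) ≠ 0 := by simp
  have hloc : ContDiffAt ℝ ∞ (hfa.localInverse hFs.hasFDerivAt hn) (F a) :=
    hfa.to_localInverse hFs.hasFDerivAt hn
  have heq : ∀ᶠ z in 𝓝 (F a), invFunOn F V z = hfa.localInverse hFs.hasFDerivAt hn z := by
    refine (hfa.hasStrictFDerivAt' hFs.hasFDerivAt hn).localInverse_unique ?_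
    filter_upwards [hV.mem_nhds ha] with x hx
    exact hinj.leftInvOn_invFunOn hx
  exact (hloc.congr_of_eventuallyEq heq).contDiffWithinAt

end OnVersions

end Summit.SmoothPoincare4.SmoothPoincare4.Theorems.OrigamiFoldExistence.ShadowPleats

end
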